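import Mathlib.Analysis.PSeries
import Literature.Computability.Complexity.WalshDyadicFourier
import HarnessLib

/-!
# `DigitPolyUniformity` (stmt-QuantumAdvantage-1392) — line `Sketch`, stub `stub_singleDigit`:
# counting lemmas

Elementary counting behind the decorrelation of prime dilates of one binary digit
(`stub_singleDigit`, file `MobiusLadderDigitPolyUniformityStubSingleDigit.lean`). After the digit
square wave of period `P = 2^{j+1}` is expanded in its finite Fourier series with coefficients
`|ĝ(h)| ≤ 2/min(h, P−h)`, `ĝ(0) = 0`, the dilate correlation over a period is the PARTNER SUM
`Σ_{h,h'<P, P ∣ ph+qh'} ĝ(h)ĝ(h')`. This file bounds it (`double_sum_le`):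

* `card_filter_dvd_le_one`: for `r` coprime to `P` each `h` has at most one partner `h'`;
* `key_dichotomy`: for partners `0 < h, h' < P` the distances `a = min(h, P−h)`, `b = min(h', P−h')`
  satisfy `pa = qb` or `pa + qb ≥ P` (signed representatives: `±pa ± qb ∈ Pℤ`);
* `one_div_mul_le`: hence `1/(ab) ≤ (q/p)[q ∣ a]/a² + (p+q)/P · (1/a + 1/b)` (`p, q` coprime);
* the one-dimensional sums `Σ_{h<P} 1/min(h,P−h) ≤ 2(1 + log P)` (the tree's
  `WalshDyadic.sum_Ioo_inv_min_le`) and `Σ_{q ∣ min} 1/min² ≤ 4/q²` (Mathlib's `sum_Ioo_inv_sq_le`);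
* `double_sum_le` (registered explicit-binder form: `singleDigit_partner_sum_le`):
  `Σ ‖c(h)‖‖c(h')‖ ≤ 16/(pq) + 16(p+q)(1 + log P)/P`.

Conventions: Lean's `1/0 = 0` makes the `h = 0` terms vanish automatically. Everything is
[folklore] finite combinatorics.
-/

noncomputable section

namespace Summit.QuantumAdvantage.DigitPolyUniformity.Sketch

open Finset

namespace StubSingleDigit

open Literature.Computability.Complexity.WalshDyadic (sum_Ioo_inv_min_le)

/-! ### Counting: at most one partner, and the key dichotomy -/

/-- For `r` coprime to `P`, the congruence `c + r x ≡ 0 (mod P)` has at most one solution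
`x < P`. [folklore] -/
theorem card_filter_dvd_le_one {P r : ℕ} (hr : Nat.Coprime P r) (c : ℕ) :
    ((range P).filter (fun x => P ∣ c + r * x)).card ≤ 1 := by
  refine Finset.card_le_one.2 fun x hx y hy => ?_
  rw [Finset.mem_filter, Finset.mem_range] at hx hy
  have h1 : c + r * x ≡ c + r * y [MOD P] :=
    ((Nat.modEq_zero_iff_dvd.2 hx.2).trans (Nat.modEq_zero_iff_dvd.2 hy.2).symm)
  have h2 : r * x ≡ r * y [MOD P] := Nat.ModEq.add_left_cancel' c h1
  have h3 : x ≡ y [MOD P] := Nat.ModEq.cancel_left_of_coprime hr h2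
  exact Nat.ModEq.eq_of_lt_of_lt h3 hx.1 hy.1

/-- Summing an `h`-dependent nonnegative weight over the pairs `(h, h')` with `P ∣ c(h) + r h'`,
`r` coprime to `P`: each `h` has at most one partner. [folklore] -/
theorem sum_sum_ite_dvd_le {P r : ℕ} (hr : Nat.Coprime P r) (c : ℕ → ℕ) (f : ℕ → ℝ)
    (hf : ∀ h, 0 ≤ f h) (S : Finset ℕ) :
    ∑ h ∈ S, ∑ h' ∈ range P, (if P ∣ c h + r * h' then f h else 0) ≤ ∑ h ∈ S, f h := by
  refine Finset.sum_le_sum fun h _ => ?_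
  rw [← Finset.sum_filter, Finset.sum_const, nsmul_eq_mul]
  have hcard : ((((range P).filter (fun x => P ∣ c h + r * x)).card : ℕ) : ℝ) ≤ 1 := by
    exact_mod_cast card_filter_dvd_le_one hr (c h)
  calc _ ≤ (1 : ℝ) * f h := mul_le_mul_of_nonneg_right hcard (hf h)
    _ = f h := one_mul _

/-- A signed representative: for `h < P` there is an integer `s ≡ h (mod P)` with
`|s| = min(h, P − h)`. [folklore] -/
theorem exists_signedRep {P h : ℕ} (hh : h < P) :
    ∃ s : ℤ, (P : ℤ) ∣ s - h ∧ |s| = ((min h (P - h) : ℕ) : ℤ) := by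
  by_cases hle : h ≤ P - h
  · refine ⟨h, by simp, ?_⟩
    rw [min_eq_left hle, Nat.abs_cast]
  · push Not at hle
    refine ⟨(h : ℤ) - P, ⟨-1, by ring⟩, ?_⟩
    rw [min_eq_right hle.le, abs_of_nonpos (by omega), Nat.cast_sub hh.le]
    ring

/-- **The key dichotomy.** If `0 < h, h' < P` and `P ∣ p h + q h'`, then the distances
`a = min(h, P−h)`, `b = min(h', P−h')` to `0` mod `P` satisfy `p a = q b` or `P ≤ p a + q b`
(write `h ≡ ±a`, `h' ≡ ±b`; the integer `±pa ± qb` is a multiple of `P`, hence zero or of size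
`≥ P`). [folklore] -/
theorem key_dichotomy {P p q h h' : ℕ} (hh : h < P) (hh' : h' < P)
    (hdvd : P ∣ p * h + q * h') :
    p * min h (P - h) = q * min h' (P - h') ∨ P ≤ p * min h (P - h) + q * min h' (P - h') := by
  obtain ⟨s, hs, hsa⟩ := exists_signedRep hh
  obtain ⟨t, ht, htb⟩ := exists_signedRep hh'
  have hdvd' : (P : ℤ) ∣ p * s + q * t := by
    have h1 : (P : ℤ) ∣ ((p * h + q * h' : ℕ) : ℤ) := Int.natCast_dvd_natCast.2 hdvd
    have e : (p : ℤ) * s + q * t = ((p * h + q * h' : ℕ) : ℤ) + p * (s - h) + q * (t - h') := by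
      push_cast; ring
    rw [e]
    exact dvd_add (dvd_add h1 (dvd_mul_of_dvd_right hs _)) (dvd_mul_of_dvd_right ht _)
  rcases eq_or_ne ((p : ℤ) * s + q * t) 0 with h0 | h0
  · left
    have e1 : (p : ℤ) * s = -(q * t) := by linarith
    have e2 : |(p : ℤ) * s| = |(q : ℤ) * t| := by rw [e1, abs_neg]
    rw [abs_mul, abs_mul, Nat.abs_cast, Nat.abs_cast, hsa, htb] at e2
    exact_mod_cast e2
  · right
    have h1 : (P : ℤ) ≤ |(p : ℤ) * s + q * t| := Int.le_of_dvd (abs_pos.2 h0) ((dvd_abs _ _).2 hdvd')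
    have h2 : |(p : ℤ) * s + q * t| ≤ p * |s| + q * |t| := by
      calc _ ≤ |(p : ℤ) * s| + |(q : ℤ) * t| := abs_add_le _ _
        _ = _ := by rw [abs_mul, abs_mul, Nat.abs_cast, Nat.abs_cast]
    rw [hsa, htb] at h2
    exact_mod_cast h1.trans h2

/-- The dichotomy as a bound on `1/(ab)`: `1/(ab) ≤ [q ∣ a] q/(p a²) + (p+q)/P · (1/a + 1/b)`
(`p, q` coprime). [folklore] -/
theorem one_div_mul_le {P p q a b : ℕ} (hP : 0 < P) (hp : 0 < p) (hq : 0 < q) (ha : 0 < a)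
    (hb : 0 < b) (hcop : Nat.Coprime p q) (h : p * a = q * b ∨ P ≤ p * a + q * b) :
    (1 : ℝ) / ((a : ℝ) * b) ≤
      (q : ℝ) / p * (if q ∣ a then 1 / (a : ℝ) ^ 2 else 0) + ((p : ℝ) + q) / P * (1 / a + 1 / b) := by
  have hP0 : (0 : ℝ) < P := by exact_mod_cast hP
  have hp0 : (0 : ℝ) < p := by exact_mod_cast hp
  have hq0 : (0 : ℝ) < q := by exact_mod_cast hq
  have ha0 : (0 : ℝ) < a := by exact_mod_cast ha
  have hb0 : (0 : ℝ) < b := by exact_mod_cast hb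
  have hA : 0 ≤ (q : ℝ) / p * (if q ∣ a then 1 / (a : ℝ) ^ 2 else 0) := by split_ifs <;> positivity
  have hB : 0 ≤ ((p : ℝ) + q) / P * (1 / a + 1 / b) := by positivity
  rcases h with h | h
  · have hqa : q ∣ a := hcop.symm.dvd_of_dvd_mul_left ⟨b, h⟩
    rw [if_pos hqa]
    have hb' : (b : ℝ) = p * a / q := by
      rw [eq_div_iff hq0.ne']
      have : ((p * a : ℕ) : ℝ) = ((q * b : ℕ) : ℝ) := by rw [h]
      push_cast at this
      linarith
    calc (1 : ℝ) / ((a : ℝ) * b) = (q : ℝ) / p * (1 / (a : ℝ) ^ 2) := by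
          rw [hb']; field_simp
      _ ≤ _ := le_add_of_nonneg_right hB
  · have h' : (P : ℝ) ≤ p * a + q * b := by exact_mod_cast h
    calc (1 : ℝ) / ((a : ℝ) * b) ≤ ((p : ℝ) + q) / P * (1 / a + 1 / b) := by
          rw [div_add_div _ _ ha0.ne' hb0.ne', one_mul, mul_one, div_mul_div_comm,
            div_le_div_iff₀ (by positivity) (by positivity), one_mul]
          have h1 : (P : ℝ) * (a * b) ≤ (p * a + q * b) * (a * b) :=
            mul_le_mul_of_nonneg_right h' (by positivity)
          have e : ((p : ℝ) + q) * (b + a) * (a * b) =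
              (p * a + q * b) * (a * b) + (p * b + q * a) * (a * b) := by ring
          have h2 : (0 : ℝ) ≤ (p * b + q * a) * (a * b) := by positivity
          linarith
      _ ≤ _ := le_add_of_nonneg_left hA

/-- The symmetric form of `sum_sum_ite_dvd_le`: an `h'`-dependent weight, each `h'` having at most
one partner `h`. [folklore] -/
theorem sum_sum_ite_dvd_le' {P r : ℕ} (hr : Nat.Coprime P r) (c : ℕ → ℕ) (f : ℕ → ℝ)
    (hf : ∀ h, 0 ≤ f h) (S : Finset ℕ) :
    ∑ h ∈ range P, ∑ h' ∈ S, (if P ∣ r * h + c h' then f h' else 0) ≤ ∑ h' ∈ S, f h' := by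
  rw [Finset.sum_comm]
  have e : ∀ h h', (P ∣ r * h + c h') ↔ (P ∣ c h' + r * h) := fun h h' => by rw [add_comm]
  simp_rw [e]
  exact sum_sum_ite_dvd_le hr c f hf S

/-! ### One-dimensional sums -/

/-- `Σ_{h<P} 1/min(h, P−h) ≤ 2(1 + log P)` (the `h = 0` term is `1/0 = 0`). [folklore] -/
theorem sum_range_one_div_min_le (P : ℕ) :
    ∑ h ∈ range P, (1 : ℝ) / ((min h (P - h) : ℕ) : ℝ) ≤ 2 * (1 + Real.log P) := by
  have hsub : Ioo 0 P ⊆ range P := fun x hx => by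
    rw [Finset.mem_Ioo] at hx; rw [Finset.mem_range]; exact hx.2
  rw [← Finset.sum_subset hsub (fun x hx hx' => by
      have : x = 0 := by rw [Finset.mem_range] at hx; rw [Finset.mem_Ioo] at hx'; omega
      simp [this])]
  simp_rw [one_div]
  exact sum_Ioo_inv_min_le P

/-- Multiples of `q`: `Σ_{x<N, q∣x} 1/x² ≤ 2/q²` (the `x = 0` term is `1/0 = 0`). [folklore] -/
theorem sum_range_ite_dvd_sq_le {q : ℕ} (hq : 0 < q) (N : ℕ) :
    ∑ x ∈ range N, (if q ∣ x then (1 : ℝ) / (x : ℝ) ^ 2 else 0) ≤ 2 / (q : ℝ) ^ 2 := by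
  have hq0 : (0 : ℝ) < q := by exact_mod_cast hq
  rw [← Finset.sum_filter]
  have hinj : Set.InjOn (fun x => x / q) ↑((range N).filter (fun x => q ∣ x)) := by
    intro x hx y hy hxy
    have hx' : q ∣ x := (Finset.mem_filter.1 (Finset.mem_coe.1 hx)).2
    have hy' : q ∣ y := (Finset.mem_filter.1 (Finset.mem_coe.1 hy)).2
    have hxy' : x / q = y / q := hxy
    calc x = q * (x / q) := (Nat.mul_div_cancel' hx').symm
      _ = q * (y / q) := by rw [hxy']
      _ = y := Nat.mul_div_cancel' hy'
  have hsub : ((range N).filter (fun x => q ∣ x)).image (fun x => x / q) ⊆ range N := by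
    intro t ht
    rw [Finset.mem_image] at ht
    obtain ⟨x, hx, rfl⟩ := ht
    rw [Finset.mem_filter, Finset.mem_range] at hx
    rw [Finset.mem_range]
    exact lt_of_le_of_lt (Nat.div_le_self x q) hx.1
  calc ∑ x ∈ (range N).filter (fun x => q ∣ x), (1 : ℝ) / (x : ℝ) ^ 2
      = ∑ x ∈ (range N).filter (fun x => q ∣ x),
          (fun t : ℕ => (1 : ℝ) / ((q : ℝ) * t) ^ 2) (x / q) := by
        refine Finset.sum_congr rfl fun x hx => ?_
        rw [Finset.mem_filter] at hx
        have e : (x : ℝ) = (q : ℝ) * ((x / q : ℕ) : ℝ) := by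
          exact_mod_cast (Nat.mul_div_cancel' hx.2).symm
        simp only
        rw [← e]
    _ = ∑ t ∈ ((range N).filter (fun x => q ∣ x)).image (fun x => x / q),
          (1 : ℝ) / ((q : ℝ) * t) ^ 2 := by rw [Finset.sum_image hinj]
    _ ≤ ∑ t ∈ range N, (1 : ℝ) / ((q : ℝ) * t) ^ 2 :=
        Finset.sum_le_sum_of_subset_of_nonneg hsub fun _ _ _ => by positivity
    _ = ∑ t ∈ Ioo 0 N, ((q : ℝ) ^ 2)⁻¹ * ((t : ℝ) ^ 2)⁻¹ := by
        have hsub' : Ioo 0 N ⊆ range N := fun x hx => by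
          rw [Finset.mem_Ioo] at hx; rw [Finset.mem_range]; exact hx.2
        rw [← Finset.sum_subset hsub' (fun x hx hx' => by
          have : x = 0 := by rw [Finset.mem_range] at hx; rw [Finset.mem_Ioo] at hx'; omega
          simp [this])]
        refine Finset.sum_congr rfl fun t _ => ?_
        rw [mul_pow, one_div, mul_inv]
    _ = ((q : ℝ) ^ 2)⁻¹ * ∑ t ∈ Ioo 0 N, ((t : ℝ) ^ 2)⁻¹ := by rw [Finset.mul_sum]
    _ ≤ ((q : ℝ) ^ 2)⁻¹ * 2 := by
        refine mul_le_mul_of_nonneg_left ?_ (by positivity)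
        have := sum_Ioo_inv_sq_le (α := ℝ) 0 N
        norm_num at this
        exact this
    _ = 2 / (q : ℝ) ^ 2 := by rw [inv_mul_eq_div]

/-- `Σ_{h<P, q ∣ min(h,P−h)} 1/min(h, P−h)² ≤ 4/q²`. [folklore] -/
theorem sum_range_ite_dvd_min_le {q : ℕ} (hq : 0 < q) (P : ℕ) :
    ∑ h ∈ range P, (if q ∣ min h (P - h) then (1 : ℝ) / ((min h (P - h) : ℕ) : ℝ) ^ 2 else 0) ≤
      4 / (q : ℝ) ^ 2 := by
  obtain ⟨F, hF⟩ : ∃ F : ℕ → ℝ, ∀ x, F x = if q ∣ x then (1 : ℝ) / (x : ℝ) ^ 2 else 0 :=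
    ⟨_, fun _ => rfl⟩
  have hF0 : ∀ x, 0 ≤ F x := fun x => by rw [hF]; split_ifs <;> positivity
  have hpt : ∀ h ∈ range P,
      (if q ∣ min h (P - h) then (1 : ℝ) / ((min h (P - h) : ℕ) : ℝ) ^ 2 else 0) ≤ F h + F (P - h) := by
    intro h _
    rcases min_choice h (P - h) with hm | hm <;> rw [hm]
    · rw [← hF h]; linarith [hF0 (P - h)]
    · rw [← hF (P - h)]; linarith [hF0 h]
  refine (Finset.sum_le_sum hpt).trans ?_
  rw [Finset.sum_add_distrib]
  have h1 : ∑ h ∈ range P, F h ≤ 2 / (q : ℝ) ^ 2 := by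
    simp_rw [hF]; exact sum_range_ite_dvd_sq_le hq P
  have h2 : ∑ h ∈ range P, F (P - h) ≤ 2 / (q : ℝ) ^ 2 := by
    calc ∑ h ∈ range P, F (P - h) ≤ ∑ h ∈ range (P + 1), F (P - h) := by
          rw [Finset.sum_range_succ]; linarith [hF0 (P - P)]
      _ = ∑ h ∈ range (P + 1), F (P + 1 - 1 - h) := by simp only [Nat.add_sub_cancel]
      _ = ∑ x ∈ range (P + 1), F x := Finset.sum_range_reflect F (P + 1)
      _ ≤ _ := by simp_rw [hF]; exact sum_range_ite_dvd_sq_le hq (P + 1)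
  calc _ ≤ 2 / (q : ℝ) ^ 2 + 2 / (q : ℝ) ^ 2 := add_le_add h1 h2
    _ = 4 / (q : ℝ) ^ 2 := by ring

/-! ### The double sum over partners -/

/-- **The partner sum.** For coefficients with `c(0) = 0` and `‖c(h)‖ ≤ 2/min(h, P−h)`, and `p, q`
coprime to each other and to `P`:
`Σ_{h,h'<P, P ∣ ph+qh'} ‖c(h)‖‖c(h')‖ ≤ 16/(pq) + 16(p+q)(1 + log P)/P`. [folklore] -/
theorem double_sum_le {P p q : ℕ} (hP : 0 < P) (hp : 0 < p) (hq : 0 < q) (hcop : Nat.Coprime p q)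
    (hPp : Nat.Coprime P p) (hPq : Nat.Coprime P q) (c : ℕ → ℂ) (hc0 : c 0 = 0)
    (hcb : ∀ h, 0 < h → h < P → ‖c h‖ ≤ 2 / ((min h (P - h) : ℕ) : ℝ)) :
    ∑ h ∈ range P, ∑ h' ∈ range P, (if P ∣ p * h + q * h' then ‖c h‖ * ‖c h'‖ else 0) ≤
      16 / ((p : ℝ) * q) + 16 * ((p : ℝ) + q) / P * (1 + Real.log P) := by
  obtain ⟨D, hD⟩ : ∃ D : ℕ → ℝ, ∀ h, D h = ((min h (P - h) : ℕ) : ℝ) := ⟨_, fun _ => rfl⟩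
  obtain ⟨A, hA⟩ : ∃ A : ℕ → ℝ, ∀ h, A h =
      (q : ℝ) / p * (if q ∣ min h (P - h) then 1 / D h ^ 2 else 0) := ⟨_, fun _ => rfl⟩
  have hp0 : (0 : ℝ) < p := by exact_mod_cast hp
  have hq0 : (0 : ℝ) < q := by exact_mod_cast hq
  have hP0 : (0 : ℝ) < P := by exact_mod_cast hP
  have hDnn : ∀ h, 0 ≤ D h := fun h => by rw [hD]; positivity
  have hD1 : ∀ h, 0 ≤ 1 / D h := fun h => by have := hDnn h; positivity
  have hA0 : ∀ h, 0 ≤ A h := fun h => by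
    rw [hA]; have := hDnn h; split_ifs <;> positivity
  have hcb' : ∀ h, h < P → ‖c h‖ ≤ 2 / D h := by
    intro h hh
    rcases Nat.eq_zero_or_pos h with rfl | h0
    · rw [hc0, norm_zero, hD]; simp
    · rw [hD]; exact hcb h h0 hh
  -- termwise bound
  have hterm : ∀ h ∈ range P, ∀ h' ∈ range P,
      (if P ∣ p * h + q * h' then ‖c h‖ * ‖c h'‖ else 0) ≤
        4 * (if P ∣ p * h + q * h' then A h else 0) +
          4 * ((p : ℝ) + q) / P * ((if P ∣ p * h + q * h' then 1 / D h else 0) +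
            (if P ∣ p * h + q * h' then 1 / D h' else 0)) := by
    intro h hh h' hh'
    rw [Finset.mem_range] at hh hh'
    by_cases hd : P ∣ p * h + q * h'
    · rw [if_pos hd, if_pos hd, if_pos hd, if_pos hd]
      have hR : 0 ≤ 4 * A h + 4 * ((p : ℝ) + q) / P * (1 / D h + 1 / D h') := by
        have := hA0 h; have := hD1 h; have := hD1 h'; positivity
      rcases Nat.eq_zero_or_pos h with rfl | h0
      · rw [hc0, norm_zero, zero_mul]; exact hR
      rcases Nat.eq_zero_or_pos h' with rfl | h0'
      · rw [hc0, norm_zero, mul_zero]; exact hR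
      have hmin : 0 < min h (P - h) := lt_min h0 (by omega)
      have hmin' : 0 < min h' (P - h') := lt_min h0' (by omega)
      have hi := one_div_mul_le hP hp hq hmin hmin' hcop (key_dichotomy hh hh' hd)
      rw [← hD h, ← hD h'] at hi
      have hDh : 0 < D h := by rw [hD]; exact_mod_cast hmin
      have hDh' : 0 < D h' := by rw [hD]; exact_mod_cast hmin'
      calc ‖c h‖ * ‖c h'‖ ≤ (2 / D h) * (2 / D h') :=
            mul_le_mul (hcb' h hh) (hcb' h' hh') (norm_nonneg _) (by positivity)
        _ = 4 * (1 / (D h * D h')) := by ring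
        _ ≤ 4 * ((q : ℝ) / p * (if q ∣ min h (P - h) then 1 / D h ^ 2 else 0) +
              ((p : ℝ) + q) / P * (1 / D h + 1 / D h')) :=
            mul_le_mul_of_nonneg_left hi (by norm_num)
        _ = 4 * A h + 4 * ((p : ℝ) + q) / P * (1 / D h + 1 / D h') := by rw [hA]; ring
    · rw [if_neg hd, if_neg hd, if_neg hd, if_neg hd]; simp
  refine (Finset.sum_le_sum fun h hh => Finset.sum_le_sum fun h' hh' => hterm h hh h' hh').trans ?_
  -- evaluate the three partner sums
  have hS1 : ∑ h ∈ range P, ∑ h' ∈ range P, (if P ∣ p * h + q * h' then A h else 0) ≤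
      (q : ℝ) / p * (4 / (q : ℝ) ^ 2) := by
    refine (sum_sum_ite_dvd_le hPq (fun h => p * h) A hA0 (range P)).trans ?_
    simp_rw [hA, ← Finset.mul_sum]
    refine mul_le_mul_of_nonneg_left ?_ (by positivity)
    simp_rw [hD]
    exact sum_range_ite_dvd_min_le hq P
  have hS2 : ∑ h ∈ range P, ∑ h' ∈ range P, (if P ∣ p * h + q * h' then 1 / D h else 0) ≤
      2 * (1 + Real.log P) := by
    refine (sum_sum_ite_dvd_le hPq (fun h => p * h) (fun h => 1 / D h) hD1 (range P)).trans ?_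
    simp_rw [hD]
    exact sum_range_one_div_min_le P
  have hS3 : ∑ h ∈ range P, ∑ h' ∈ range P, (if P ∣ p * h + q * h' then 1 / D h' else 0) ≤
      2 * (1 + Real.log P) := by
    refine (sum_sum_ite_dvd_le' hPp (fun h' => q * h') (fun h' => 1 / D h') hD1 (range P)).trans ?_
    simp_rw [hD]
    exact sum_range_one_div_min_le P
  have hlog : 0 ≤ 1 + Real.log P := by
    have : 0 ≤ Real.log P := Real.log_nonneg (by exact_mod_cast hP)
    linarith
  have hsplit : ∑ h ∈ range P, ∑ h' ∈ range P,
      (4 * (if P ∣ p * h + q * h' then A h else 0) +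
        4 * ((p : ℝ) + q) / P * ((if P ∣ p * h + q * h' then 1 / D h else 0) +
          (if P ∣ p * h + q * h' then 1 / D h' else 0))) =
      4 * ∑ h ∈ range P, ∑ h' ∈ range P, (if P ∣ p * h + q * h' then A h else 0) +
        4 * ((p : ℝ) + q) / P *
          (∑ h ∈ range P, ∑ h' ∈ range P, (if P ∣ p * h + q * h' then 1 / D h else 0) +
            ∑ h ∈ range P, ∑ h' ∈ range P, (if P ∣ p * h + q * h' then 1 / D h' else 0)) := by
    simp only [Finset.sum_add_distrib, Finset.mul_sum, mul_add]
  rw [hsplit]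
  have h4 : 0 ≤ 4 * ((p : ℝ) + q) / P := by positivity
  calc _ ≤ 4 * ((q : ℝ) / p * (4 / (q : ℝ) ^ 2)) +
        4 * ((p : ℝ) + q) / P * (2 * (1 + Real.log P) + 2 * (1 + Real.log P)) := by
        gcongr
    _ = 16 / ((p : ℝ) * q) + 16 * ((p : ℝ) + q) / P * (1 + Real.log P) := by
        field_simp
        ring

end StubSingleDigit

/-- **Registered sub-goal (the partner sum), explicit-binder form of
`StubSingleDigit.double_sum_le`.** For coefficients `c` with `c(0) = 0`, `‖c(h)‖ ≤ 2/min(h, P−h)`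
(`0 < h < P`), and `p, q` coprime to each other and to `P`:
`Σ_{h,h'<P, P ∣ ph+qh'} ‖c(h)‖‖c(h')‖ ≤ 16/(pq) + 16(p+q)(1 + log P)/P`. [folklore] -/
theorem singleDigit_partner_sum_le :
    ∀ P p q : ℕ, 0 < P → 0 < p → 0 < q → Nat.Coprime p q → Nat.Coprime P p → Nat.Coprime P q →
      ∀ c : ℕ → ℂ, c 0 = 0 → (∀ h : ℕ, 0 < h → h < P → ‖c h‖ ≤ 2 / ((min h (P - h) : ℕ) : ℝ)) →
        ∑ h ∈ Finset.range P, ∑ h' ∈ Finset.range P,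
            (if P ∣ p * h + q * h' then ‖c h‖ * ‖c h'‖ else 0) ≤
          16 / ((p : ℝ) * q) + 16 * ((p : ℝ) + q) / P * (1 + Real.log P) := by
  intro P p q hP hp hq hcop hPp hPq c hc0 hcb
  exact StubSingleDigit.double_sum_le hP hp hq hcop hPp hPq c hc0 hcb

end Summit.QuantumAdvantage.DigitPolyUniformity.Sketch

end
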